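import Literature.NumberTheory.Automorphic.UnitaryGroupRationalHeisenbergSplit
import Literature.NumberTheory.Automorphic.UnitaryGroupTruncatedTraceClassUnipotentUnfold
import HarnessLib

/-!
# The bracket of the unipotent term splits into its centre piece `ψᶜ` and its Heisenberg piece `ψʳ_T`:
# the split BY NAME, measurability, left `B(F)`-invariance and absolute integrability of `ψʳ_T`
(Rogawski (1990), Prop. 7.3.2, pp. 96–97; §7.3 p. 95 «these two terms are separately integrable»)

Topic `NumberTheory/Automorphic`; namespace `Literature.NumberTheory.Automorphic.UnitaryGroup`. THEOREMS ONLY over accepted tree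
modules (no definition, no named fact, no instance, no notation, no `sorry`). Row (E-G) FILE A of the Heisenberg part (E) of the
unipotent term `P_{z·𝒰}` (LAW 5 road of `Cruxes/H413/Lines/F0_T1InnerFormTraceIdentity.lean`, crux H413; cell hodgecm-mathlib).

Letters of ★ B1 `UnitaryGroupTruncatedTraceClassUnipotentUnfold` VERBATIM: `ζ ∈ E¹`, `z₁ ∈ G(F)` with `↑z₁ = toAdelic (ratCenter ζ)`, the
bracket `ψ_T(g) = Σ'_{u ∈ N(F), u ≠ 1} f(g⁻¹ (z₁ u) g) − 1_{T < H(g)} K_{B,𝔬}(g, g)` spelled INLINE; `u(ξ, w) := heisChart hc (algebraMap ξ, w)`.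
The CENTRE PIECE `ψᶜ(g) := Σ'_{w ∈ E⁻ ∖ 0} f(g⁻¹ (z₁ u(0, w)) g)` and the HEISENBERG PIECE
`ψʳ_T(g) := Σ'_{ξ ∈ E^×} Σ'_{w ∈ E⁻} f(g⁻¹ (z₁ u(ξ, w)) g) − 1_{T < H(g)} K_{B,𝔬}(g, g)` (both INLINE; the currency pins of the (F) assembly ★
`UnitaryGroupUnipotentTruncatedTracePolynomial`, hypothesis `hsplit`).

* §1 **`bracket_eq_centrePart_add_heisPart`** — `ψ_T(g) = ψᶜ(g) + ψʳ_T(g)` for every `g` (★ (E0) `tsum_rationalUnipotent_ne_one_eq_add`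
  at `G(g') := f(g⁻¹ (z₁ g') g)`, summable by ★ `summable_kernel_of_hasCompactSupport`): THE `hsplit` OF (F) BY NAME.
* §2 `measurable_centrePart`, `measurable_heisPart` (countable sums of continuous functions, ★ `measurable_kernelBorelTailClass`).
* §3 `heisPart_rational_borel_mul_of_centrePart` — `ψʳ_T(b g) = ψʳ_T(g)` for `b ∈ B(F)`, GIVEN the same for `ψᶜ` (hypothesis `hCinv`, owed by
  the (C) assembly): `ψʳ_T = ψ_T − ψᶜ` and ★ `bracket_rational_borel_mul`.
* §4 **`lintegral_weight_mul_enorm_heisPart_lt_top`** — `∫⁻ β ‖ψʳ_T‖ₑ dν_G < ∞` from (HINT) `∫⁻ β ‖ψ_T‖ₑ < ∞` (★ A-p13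
  `exists_forall_lintegral_weight_mul_enorm_bracket_lt_top`) and `hCfin : ∫⁻ β ‖ψᶜ‖ₑ < ∞` (owed by (C)): `‖ψʳ_T‖ₑ ≤ ‖ψ_T‖ₑ + ‖ψᶜ‖ₑ`.

## References
* J. D. Rogawski, *Automorphic Representations of Unitary Groups in Three Variables*, Ann. of Math. Stud. 123 (1990), §7.3 Prop. 7.3.2
  (pp. 95–97) [Rogawski1990].
* J. Arthur, *A trace formula for reductive groups I*, Duke Math. J. 45 (1978), §8 [Arthur1978TraceFormulaI].
-/

set_option autoImplicit false

noncomputable section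

open Matrix NumberField IsDedekindDomain Topology MeasureTheory Measure Set Polynomial
open scoped MatrixGroups ENNReal NNReal

namespace Literature.NumberTheory.Automorphic

namespace UnitaryGroup

variable {F E : Type} [Field F] [NumberField F] [Field E] [NumberField E] [Algebra F E]
  {c : E ≃ₐ[F] E} {ι : Type*}

variable (ζ : ratOne F E c) {z₁ : (quasiSplit F E c 3).arithmeticSubgroup}

omit [NumberField F] in
/-- `E⁻ = rationalTraceZero` is countable (it injects into `E`). [folklore] -/
private theorem countable_rationalTraceZero₂ : Countable (rationalTraceZero F E c) := countable_rationalTraceZero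

/-- `E` is countable. [folklore] -/
private theorem countable_E : Countable E := NumberField.countable' (K := E)

section Split

variable [MeasurableSpace (adelicUnipotent F E c 3)]

/-! ## §1 The split `ψ_T = ψᶜ + ψʳ_T` by name -/

/-- **`ψ_T(g) = ψᶜ(g) + ψʳ_T(g)`** — THE `hsplit` OF THE (F) ASSEMBLY ★ `truncatedTraceClass_central_eq_linear_of_parts`, BY NAME: the class sum over
`u ∈ N(F) ∖ 1` splits by the root coordinate into the centre lattice `u(0, w)`, `w ≠ 0`, and the Heisenberg part `u(ξ, w)`, `ξ ≠ 0` (★ (E0)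
`tsum_rationalUnipotent_ne_one_eq_add` at `G(g') = f(g⁻¹ (z₁ g') g)`, summable because `f ∈ C_c` ★ `summable_kernel_of_hasCompactSupport`); the tail
goes with the Heisenberg part. [cite: Rogawski1990, §7.3 Prop. 7.3.2 (pp. 96–97)] -/
theorem bracket_eq_centrePart_add_heisPart {cl : (quasiSplit F E c 3).arithmeticSubgroup → ι} (hc : c * c = 1)
    (ν : Measure (adelicUnipotent F E c 3)) (𝓕 : Set (adelicUnipotent F E c 3)) (T : ℝ≥0) (i : ι)
    {f : (quasiSplit F E c 3).Adelic → ℂ} (hf : HasCompactSupport f) (g : (quasiSplit F E c 3).Adelic) :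
    (∑' u : {u : rationalUnipotent F E c 3 // u ≠ 1},
        f (g⁻¹ * ((z₁ * ⟨(((u.1 : rationalUnipotent F E c 3) : adelicUnipotent F E c 3) :
          (quasiSplit F E c 3).Adelic), (u.1 : rationalUnipotent F E c 3).2⟩ :
            (quasiSplit F E c 3).arithmeticSubgroup) : (quasiSplit F E c 3).Adelic) * g)) -
      kernelBorelTailClass ν 𝓕 T cl i f g =
    (∑' w : {w : rationalTraceZero F E c // w ≠ 0},
        f (g⁻¹ * ((z₁ : (quasiSplit F E c 3).Adelic) *
          (((heisChart hc ((0 : AdeleRing (𝓞 E) E), ((w.1 : rationalTraceZero F E c) : traceZeroAdele F E c))) :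
            adelicUnipotent F E c 3) : (quasiSplit F E c 3).Adelic)) * g)) +
    ((∑' ξ : {ξ : E // ξ ≠ 0}, ∑' w : rationalTraceZero F E c,
        f (g⁻¹ * ((z₁ : (quasiSplit F E c 3).Adelic) *
          (((heisChart hc (algebraMap E (AdeleRing (𝓞 E) E) (ξ : E), (w : traceZeroAdele F E c))) :
            adelicUnipotent F E c 3) : (quasiSplit F E c 3).Adelic)) * g)) -
      kernelBorelTailClass ν 𝓕 T cl i f g) := by
  -- the class family as a function of the adelic point, summable
  have hsum : Summable fun u : {u : rationalUnipotent F E c 3 // u ≠ 1} =>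
      (fun g' : (quasiSplit F E c 3).Adelic => f (g⁻¹ * ((z₁ : (quasiSplit F E c 3).Adelic) * g') * g))
        (((u.1 : rationalUnipotent F E c 3) : adelicUnipotent F E c 3) : (quasiSplit F E c 3).Adelic) := by
    have hj : Function.Injective (fun u : {u : rationalUnipotent F E c 3 // u ≠ 1} =>
        (z₁ * ⟨(((u.1 : rationalUnipotent F E c 3) : adelicUnipotent F E c 3) : (quasiSplit F E c 3).Adelic),
          (u.1 : rationalUnipotent F E c 3).2⟩ : (quasiSplit F E c 3).arithmeticSubgroup)) := by
      intro u v huv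
      have h1 := mul_left_cancel huv
      have h2 := congrArg (fun γ : (quasiSplit F E c 3).arithmeticSubgroup => (γ : (quasiSplit F E c 3).Adelic)) h1
      exact Subtype.ext (Subtype.ext (Subtype.ext h2))
    exact ((summable_kernel_of_hasCompactSupport hf g g).comp_injective hj).congr fun u => rfl
  have hsplit := tsum_rationalUnipotent_ne_one_eq_add hc
    (fun g' : (quasiSplit F E c 3).Adelic => f (g⁻¹ * ((z₁ : (quasiSplit F E c 3).Adelic) * g') * g)) hsum
  have hlhs : (∑' u : {u : rationalUnipotent F E c 3 // u ≠ 1},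
      f (g⁻¹ * ((z₁ * ⟨(((u.1 : rationalUnipotent F E c 3) : adelicUnipotent F E c 3) :
        (quasiSplit F E c 3).Adelic), (u.1 : rationalUnipotent F E c 3).2⟩ :
          (quasiSplit F E c 3).arithmeticSubgroup) : (quasiSplit F E c 3).Adelic) * g)) =
      ∑' u : {u : rationalUnipotent F E c 3 // u ≠ 1},
        f (g⁻¹ * ((z₁ : (quasiSplit F E c 3).Adelic) *
          (((u.1 : rationalUnipotent F E c 3) : adelicUnipotent F E c 3) : (quasiSplit F E c 3).Adelic)) * g) :=
    tsum_congr fun u => rfl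
  rw [hlhs, hsplit]
  ring

/-! ## §2 Measurability -/

variable [MeasurableSpace (quasiSplit F E c 3).Adelic] [BorelSpace (quasiSplit F E c 3).Adelic]

omit [MeasurableSpace (adelicUnipotent F E c 3)] in
/-- **The centre piece `ψᶜ` is Borel** (a countable sum of continuous functions). [cite: Rogawski1990, §7.3 (p. 95)] -/
theorem measurable_centrePart (hc : c * c = 1) {f : (quasiSplit F E c 3).Adelic → ℂ} (hfc : Continuous f) :
    Measurable fun g : (quasiSplit F E c 3).Adelic =>
      ∑' w : {w : rationalTraceZero F E c // w ≠ 0},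
        f (g⁻¹ * ((z₁ : (quasiSplit F E c 3).Adelic) *
          (((heisChart hc ((0 : AdeleRing (𝓞 E) E), ((w.1 : rationalTraceZero F E c) : traceZeroAdele F E c))) :
            adelicUnipotent F E c 3) : (quasiSplit F E c 3).Adelic)) * g) := by
  haveI : Countable (rationalTraceZero F E c) := countable_rationalTraceZero₂
  haveI : Countable {w : rationalTraceZero F E c // w ≠ 0} := Subtype.countable
  refine Measurable.tsum fun w => ?_
  exact (hfc.comp ((continuous_id.inv.mul continuous_const).mul continuous_id)).measurable

/-- **The Heisenberg piece `ψʳ_T` is Borel** (a countable double sum of continuous functions minus the Borel class tail ★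
`measurable_kernelBorelTailClass`). [cite: Rogawski1990, §7.3 (p. 95)] -/
theorem measurable_heisPart [BorelSpace (adelicUnipotent F E c 3)] {cl : (quasiSplit F E c 3).arithmeticSubgroup → ι} (hc : c * c = 1)
    (ν : Measure (adelicUnipotent F E c 3)) [SFinite ν] (𝓕 : Set (adelicUnipotent F E c 3)) (T : ℝ≥0) (i : ι)
    {f : (quasiSplit F E c 3).Adelic → ℂ} (hfc : Continuous f) :
    Measurable fun g : (quasiSplit F E c 3).Adelic =>
      (∑' ξ : {ξ : E // ξ ≠ 0}, ∑' w : rationalTraceZero F E c,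
        f (g⁻¹ * ((z₁ : (quasiSplit F E c 3).Adelic) *
          (((heisChart hc (algebraMap E (AdeleRing (𝓞 E) E) (ξ : E), (w : traceZeroAdele F E c))) :
            adelicUnipotent F E c 3) : (quasiSplit F E c 3).Adelic)) * g)) -
      kernelBorelTailClass ν 𝓕 T cl i f g := by
  haveI : Countable (rationalTraceZero F E c) := countable_rationalTraceZero₂
  haveI : Countable E := countable_E
  haveI : Countable {ξ : E // ξ ≠ 0} := Subtype.countable
  refine (Measurable.tsum fun ξ => Measurable.tsum fun w => ?_).sub (measurable_kernelBorelTailClass hfc ν 𝓕 T cl i)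
  exact (hfc.comp ((continuous_id.inv.mul continuous_const).mul continuous_id)).measurable

/-! ## §3 Left `B(F)`-invariance of `ψʳ_T` from that of `ψᶜ` -/

omit [MeasurableSpace (quasiSplit F E c 3).Adelic] [BorelSpace (quasiSplit F E c 3).Adelic] in
/-- **`ψʳ_T` is left `B(F)`-invariant provided `ψᶜ` is**: `ψʳ_T = ψ_T − ψᶜ` (§1) and the bracket `ψ_T` is left `B(F)`-invariant ★
`bracket_rational_borel_mul`. The hypothesis `hCinv` is the (C) assembly's (its own (G-b) input). [cite: Rogawski1990, §7.3 (p. 95)] -/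
theorem heisPart_rational_borel_mul_of_centrePart [BorelSpace (adelicUnipotent F E c 3)]
    {cl : (quasiSplit F E c 3).arithmeticSubgroup → ι} (hc : c * c = 1) (hc1 : c ≠ 1)
    (hz₁ : (z₁ : (quasiSplit F E c 3).Adelic) =
      (quasiSplit F E c 3).toAdelic (ratCenter F E c 3 ((StdForm.antidiagonal 3).over E) ζ))
    (hclN : IsUnipotentInvariantOnBorel F E c 3 cl)
    (ν : Measure (adelicUnipotent F E c 3)) [ν.IsHaarMeasure]
    {𝓕 : Set (adelicUnipotent F E c 3)} (h𝓕 : IsFundamentalDomain (rationalUnipotent F E c 3) 𝓕 ν) (T : ℝ≥0)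
    {f : (quasiSplit F E c 3).Adelic → ℂ} (hfc : Continuous f) (hf : HasCompactSupport f) (i : ι)
    (hCinv : ∀ b ∈ arithmeticBorel F E c 3, ∀ y : (quasiSplit F E c 3).Adelic,
      (∑' w : {w : rationalTraceZero F E c // w ≠ 0},
        f (((b : (quasiSplit F E c 3).Adelic) * y)⁻¹ * ((z₁ : (quasiSplit F E c 3).Adelic) *
          (((heisChart hc ((0 : AdeleRing (𝓞 E) E), ((w.1 : rationalTraceZero F E c) : traceZeroAdele F E c))) :
            adelicUnipotent F E c 3) : (quasiSplit F E c 3).Adelic)) * ((b : (quasiSplit F E c 3).Adelic) * y))) =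
      ∑' w : {w : rationalTraceZero F E c // w ≠ 0},
        f (y⁻¹ * ((z₁ : (quasiSplit F E c 3).Adelic) *
          (((heisChart hc ((0 : AdeleRing (𝓞 E) E), ((w.1 : rationalTraceZero F E c) : traceZeroAdele F E c))) :
            adelicUnipotent F E c 3) : (quasiSplit F E c 3).Adelic)) * y))
    (b : (quasiSplit F E c 3).arithmeticSubgroup) (hb : b ∈ arithmeticBorel F E c 3) (y : (quasiSplit F E c 3).Adelic) :
    (∑' ξ : {ξ : E // ξ ≠ 0}, ∑' w : rationalTraceZero F E c,
        f (((b : (quasiSplit F E c 3).Adelic) * y)⁻¹ * ((z₁ : (quasiSplit F E c 3).Adelic) *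
          (((heisChart hc (algebraMap E (AdeleRing (𝓞 E) E) (ξ : E), (w : traceZeroAdele F E c))) :
            adelicUnipotent F E c 3) : (quasiSplit F E c 3).Adelic)) * ((b : (quasiSplit F E c 3).Adelic) * y))) -
      kernelBorelTailClass ν 𝓕 T cl i f ((b : (quasiSplit F E c 3).Adelic) * y) =
    (∑' ξ : {ξ : E // ξ ≠ 0}, ∑' w : rationalTraceZero F E c,
        f (y⁻¹ * ((z₁ : (quasiSplit F E c 3).Adelic) *
          (((heisChart hc (algebraMap E (AdeleRing (𝓞 E) E) (ξ : E), (w : traceZeroAdele F E c))) :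
            adelicUnipotent F E c 3) : (quasiSplit F E c 3).Adelic)) * y)) -
      kernelBorelTailClass ν 𝓕 T cl i f y := by
  -- `ψʳ_T(by) = ψ_T(by) − ψᶜ(by) = ψ_T(y) − ψᶜ(y) = ψʳ_T(y)`
  have hsplit_b := bracket_eq_centrePart_add_heisPart (z₁ := z₁) (cl := cl) hc ν 𝓕 T i hf ((b : (quasiSplit F E c 3).Adelic) * y)
  have hsplit_y := bracket_eq_centrePart_add_heisPart (z₁ := z₁) (cl := cl) hc ν 𝓕 T i hf y
  have hψ := bracket_rational_borel_mul ζ hc hc1 hz₁ hclN ν h𝓕 T hfc hf i b hb y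
  rw [hsplit_b, hsplit_y, hCinv b hb y] at hψ
  exact add_left_cancel hψ

/-! ## §4 Absolute integrability of `β ‖ψʳ_T‖ₑ` -/

omit [MeasurableSpace (adelicUnipotent F E c 3)] in
/-- **`∫⁻ β ‖ψʳ_T‖ₑ dν_G < ∞`** from the (HINT) finiteness for the bracket `ψ_T` (★ `exists_forall_lintegral_weight_mul_enorm_bracket_lt_top`) and
`hCfin : ∫⁻ β ‖ψᶜ‖ₑ dν_G < ∞` (owed by the (C) assembly): `ψʳ_T = ψ_T − ψᶜ` (§1), `‖ψʳ_T‖ₑ ≤ ‖ψ_T‖ₑ + ‖ψᶜ‖ₑ` — the `hint` of ★ (G-b)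
`exists_weight_iwasawa_kAverage_three` (B) at `ψ := ψʳ_T`. [cite: Rogawski1990, §7.3 (p. 95)] [cite: Arthur1978TraceFormulaI, §8] -/
theorem lintegral_weight_mul_enorm_heisPart_lt_top [MeasurableSpace (adelicUnipotent F E c 3)]
    {cl : (quasiSplit F E c 3).arithmeticSubgroup → ι} (hc : c * c = 1)
    (ν : Measure (adelicUnipotent F E c 3)) (𝓕 : Set (adelicUnipotent F E c 3)) (T : ℝ≥0) (i : ι)
    {f : (quasiSplit F E c 3).Adelic → ℂ} (hfc : Continuous f) (hf : HasCompactSupport f)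
    (νG : Measure (quasiSplit F E c 3).Adelic) {β : (quasiSplit F E c 3).Adelic → ℝ≥0∞} (hβm : Measurable β)
    (hint : ∫⁻ g, β g * ‖(∑' u : {u : rationalUnipotent F E c 3 // u ≠ 1},
        f (g⁻¹ * ((z₁ * ⟨(((u.1 : rationalUnipotent F E c 3) : adelicUnipotent F E c 3) :
          (quasiSplit F E c 3).Adelic), (u.1 : rationalUnipotent F E c 3).2⟩ :
            (quasiSplit F E c 3).arithmeticSubgroup) : (quasiSplit F E c 3).Adelic) * g)) -
      kernelBorelTailClass ν 𝓕 T cl i f g‖ₑ ∂νG < ∞)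
    (hCfin : ∫⁻ g, β g * ‖∑' w : {w : rationalTraceZero F E c // w ≠ 0},
        f (g⁻¹ * ((z₁ : (quasiSplit F E c 3).Adelic) *
          (((heisChart hc ((0 : AdeleRing (𝓞 E) E), ((w.1 : rationalTraceZero F E c) : traceZeroAdele F E c))) :
            adelicUnipotent F E c 3) : (quasiSplit F E c 3).Adelic)) * g)‖ₑ ∂νG < ∞) :
    ∫⁻ g, β g * ‖(∑' ξ : {ξ : E // ξ ≠ 0}, ∑' w : rationalTraceZero F E c,
        f (g⁻¹ * ((z₁ : (quasiSplit F E c 3).Adelic) *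
          (((heisChart hc (algebraMap E (AdeleRing (𝓞 E) E) (ξ : E), (w : traceZeroAdele F E c))) :
            adelicUnipotent F E c 3) : (quasiSplit F E c 3).Adelic)) * g)) -
      kernelBorelTailClass ν 𝓕 T cl i f g‖ₑ ∂νG < ∞ := by
  -- pointwise: `ψʳ_T = ψ_T − ψᶜ`, so `β ‖ψʳ_T‖ₑ ≤ β ‖ψ_T‖ₑ + β ‖ψᶜ‖ₑ`
  have hpt : ∀ g : (quasiSplit F E c 3).Adelic,
      β g * ‖(∑' ξ : {ξ : E // ξ ≠ 0}, ∑' w : rationalTraceZero F E c,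
        f (g⁻¹ * ((z₁ : (quasiSplit F E c 3).Adelic) *
          (((heisChart hc (algebraMap E (AdeleRing (𝓞 E) E) (ξ : E), (w : traceZeroAdele F E c))) :
            adelicUnipotent F E c 3) : (quasiSplit F E c 3).Adelic)) * g)) -
      kernelBorelTailClass ν 𝓕 T cl i f g‖ₑ ≤
      β g * ‖(∑' u : {u : rationalUnipotent F E c 3 // u ≠ 1},
        f (g⁻¹ * ((z₁ * ⟨(((u.1 : rationalUnipotent F E c 3) : adelicUnipotent F E c 3) :
          (quasiSplit F E c 3).Adelic), (u.1 : rationalUnipotent F E c 3).2⟩ :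
            (quasiSplit F E c 3).arithmeticSubgroup) : (quasiSplit F E c 3).Adelic) * g)) -
      kernelBorelTailClass ν 𝓕 T cl i f g‖ₑ +
      β g * ‖∑' w : {w : rationalTraceZero F E c // w ≠ 0},
        f (g⁻¹ * ((z₁ : (quasiSplit F E c 3).Adelic) *
          (((heisChart hc ((0 : AdeleRing (𝓞 E) E), ((w.1 : rationalTraceZero F E c) : traceZeroAdele F E c))) :
            adelicUnipotent F E c 3) : (quasiSplit F E c 3).Adelic)) * g)‖ₑ := by
    intro g
    rw [← mul_add]
    gcongr
    -- `ψʳ_T g = ψ_T g − ψᶜ g`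
    have hs := bracket_eq_centrePart_add_heisPart (z₁ := z₁) (cl := cl) hc ν 𝓕 T i hf g
    have heq : (∑' ξ : {ξ : E // ξ ≠ 0}, ∑' w : rationalTraceZero F E c,
        f (g⁻¹ * ((z₁ : (quasiSplit F E c 3).Adelic) *
          (((heisChart hc (algebraMap E (AdeleRing (𝓞 E) E) (ξ : E), (w : traceZeroAdele F E c))) :
            adelicUnipotent F E c 3) : (quasiSplit F E c 3).Adelic)) * g)) -
      kernelBorelTailClass ν 𝓕 T cl i f g =
      ((∑' u : {u : rationalUnipotent F E c 3 // u ≠ 1},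
        f (g⁻¹ * ((z₁ * ⟨(((u.1 : rationalUnipotent F E c 3) : adelicUnipotent F E c 3) :
          (quasiSplit F E c 3).Adelic), (u.1 : rationalUnipotent F E c 3).2⟩ :
            (quasiSplit F E c 3).arithmeticSubgroup) : (quasiSplit F E c 3).Adelic) * g)) -
      kernelBorelTailClass ν 𝓕 T cl i f g) -
      ∑' w : {w : rationalTraceZero F E c // w ≠ 0},
        f (g⁻¹ * ((z₁ : (quasiSplit F E c 3).Adelic) *
          (((heisChart hc ((0 : AdeleRing (𝓞 E) E), ((w.1 : rationalTraceZero F E c) : traceZeroAdele F E c))) :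
            adelicUnipotent F E c 3) : (quasiSplit F E c 3).Adelic)) * g) := by
      rw [hs]; ring
    rw [heq]
    exact enorm_sub_le
  calc ∫⁻ g, β g * ‖(∑' ξ : {ξ : E // ξ ≠ 0}, ∑' w : rationalTraceZero F E c,
          f (g⁻¹ * ((z₁ : (quasiSplit F E c 3).Adelic) *
            (((heisChart hc (algebraMap E (AdeleRing (𝓞 E) E) (ξ : E), (w : traceZeroAdele F E c))) :
              adelicUnipotent F E c 3) : (quasiSplit F E c 3).Adelic)) * g)) -
        kernelBorelTailClass ν 𝓕 T cl i f g‖ₑ ∂νG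
      ≤ ∫⁻ g, (β g * ‖(∑' u : {u : rationalUnipotent F E c 3 // u ≠ 1},
          f (g⁻¹ * ((z₁ * ⟨(((u.1 : rationalUnipotent F E c 3) : adelicUnipotent F E c 3) :
            (quasiSplit F E c 3).Adelic), (u.1 : rationalUnipotent F E c 3).2⟩ :
              (quasiSplit F E c 3).arithmeticSubgroup) : (quasiSplit F E c 3).Adelic) * g)) -
        kernelBorelTailClass ν 𝓕 T cl i f g‖ₑ +
        β g * ‖∑' w : {w : rationalTraceZero F E c // w ≠ 0},
          f (g⁻¹ * ((z₁ : (quasiSplit F E c 3).Adelic) *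
            (((heisChart hc ((0 : AdeleRing (𝓞 E) E), ((w.1 : rationalTraceZero F E c) : traceZeroAdele F E c))) :
              adelicUnipotent F E c 3) : (quasiSplit F E c 3).Adelic)) * g)‖ₑ) ∂νG := lintegral_mono hpt
    _ ≤ (∫⁻ g, β g * ‖(∑' u : {u : rationalUnipotent F E c 3 // u ≠ 1},
          f (g⁻¹ * ((z₁ * ⟨(((u.1 : rationalUnipotent F E c 3) : adelicUnipotent F E c 3) :
            (quasiSplit F E c 3).Adelic), (u.1 : rationalUnipotent F E c 3).2⟩ :
              (quasiSplit F E c 3).arithmeticSubgroup) : (quasiSplit F E c 3).Adelic) * g)) -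
        kernelBorelTailClass ν 𝓕 T cl i f g‖ₑ ∂νG) +
        ∫⁻ g, β g * ‖∑' w : {w : rationalTraceZero F E c // w ≠ 0},
          f (g⁻¹ * ((z₁ : (quasiSplit F E c 3).Adelic) *
            (((heisChart hc ((0 : AdeleRing (𝓞 E) E), ((w.1 : rationalTraceZero F E c) : traceZeroAdele F E c))) :
              adelicUnipotent F E c 3) : (quasiSplit F E c 3).Adelic)) * g)‖ₑ ∂νG := by
          have hmeas : Measurable fun g : (quasiSplit F E c 3).Adelic =>
              β g * ‖∑' w : {w : rationalTraceZero F E c // w ≠ 0},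
                f (g⁻¹ * ((z₁ : (quasiSplit F E c 3).Adelic) *
                  (((heisChart hc ((0 : AdeleRing (𝓞 E) E), ((w.1 : rationalTraceZero F E c) : traceZeroAdele F E c))) :
                    adelicUnipotent F E c 3) : (quasiSplit F E c 3).Adelic)) * g)‖ₑ :=
            hβm.mul (measurable_centrePart (z₁ := z₁) hc hfc).enorm
          rw [lintegral_add_right _ hmeas]
    _ < ∞ := ENNReal.add_lt_top.2 ⟨hint, hCfin⟩

end Split

end UnitaryGroup

end Literature.NumberTheory.Automorphic

end
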